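import Literature.NumberTheory.Automorphic.LocalOrbitalIntegral
import Literature.MeasureTheory.Group.InvariantQuotientOrbitalTransport
import HarnessLib

/-!
# Orbital integrals, II: transport along an isomorphism of topological groups and between conjugate
elements — the named forms
(Gelbart, *Automorphic forms on adele groups* (1975), §10, pp. 154–155; Rogawski (1990), §14.2
(14.2.1) p. 232: the comparison `Φ(γ, f′_v) ↔ Φ(ψ_v γ, f_v)` along the local isomorphisms `ψ_v`)

Topic `NumberTheory/Automorphic`; namespace `Literature.NumberTheory.Automorphic`. Theorems only (no
definition, no instance, no named fact, no `sorry`): the tree's transport theorems of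
`Literature.MeasureTheory.Group.InvariantQuotientOrbitalTransport`
(`exists_integral_descConj_eq_smul_integral_descConj_comp`, `…_of_conj_eq`, `…_comp_of_conj_eq`),
restated for the NAMED orbital integral `orbitalIntegral γ f m` of `LocalOrbitalIntegral` (the `rfl`
hook `orbitalIntegral_eq_integral_descConj`):

* `exists_orbitalIntegral_eq_smul_orbitalIntegral_comp` — for a bicontinuous isomorphism
  `e : G ≃* G'` with `e γ = γ'` and non-zero invariant measures `μ` on `G ⧸ C(γ)`, `μ'` on
  `G' ⧸ C(γ')` finite on compact sets: ONE `c ≠ 0` with `O_{γ'}(F; μ') = c • O_γ(F ∘ e; μ)` for all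
  complex `F`;
* `exists_orbitalIntegral_eq_smul_orbitalIntegral_of_conj_eq` — for `γ₂ = q γ₁ q⁻¹`: ONE `c ≠ 0` with
  `O_{γ₂}(F; μ₂) = c • O_{γ₁}(F; μ₁)` (the orbital integral is a class function up to the
  normalisation of the measures);
* `exists_orbitalIntegral_eq_smul_orbitalIntegral_comp_of_conj_eq` — both at once (`q e(γ) q⁻¹ = γ₂`);
* `UnitaryGroup.exists_localOrbitalIntegral_eq_smul_comp` — the unitary-group reading: along a
  bicontinuous `ψ : U(H)(L⁺_v) ≃* U(H′)(L⁺_v)` (e.g. the local isomorphisms of the inner form with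
  the quasi-split group, `stub_T1g_locallyQuasiSplit`), `Φ(ψ γ, f; μ') = c • Φ(γ, f ∘ ψ; μ)` with one
  `c ≠ 0` for all `f` — the orbital-integral identity behind (14.2.1) «`f_v = f′_v ∘ ψ_v⁻¹` away from
  `S₀`», up to the normalisation of measures.

## References

* S. Gelbart, *Automorphic forms on adele groups*, Ann. of Math. Stud. 83 (1975), §10 pp. 154–155
  [Gelbart1975].
* J. D. Rogawski, *Automorphic Representations of Unitary Groups in Three Variables*, Ann. of Math.
  Stud. 123 (1990), §14.2 p. 232 (print) [Rogawski1990].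
* G. B. Folland, *A Course in Abstract Harmonic Analysis* (1995), Thm. 2.49 [Folland1995].
-/

noncomputable section

open MeasureTheory Measure Set Filter Topology NumberField IsDedekindDomain
open Literature.MeasureTheory.Group
open scoped ENNReal NNReal Pointwise

namespace Literature.NumberTheory.Automorphic

/-! ### Along a bicontinuous isomorphism -/

section Transport

variable {G G' : Type*} [Group G] [Group G'] [TopologicalSpace G] [TopologicalSpace G']
  [IsTopologicalGroup G'] [LocallyCompactSpace G'] [SecondCountableTopology G'] [T2Space G']
  (e : G ≃* G') (he : Continuous e) (hes : Continuous e.symm) {γ : G} {γ' : G'} (hγ : e γ = γ')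
  [MeasurableSpace (G ⧸ Subgroup.centralizer ({γ} : Set G))]
  [BorelSpace (G ⧸ Subgroup.centralizer ({γ} : Set G))]
  [MeasurableSpace (G' ⧸ Subgroup.centralizer ({γ'} : Set G'))]
  [BorelSpace (G' ⧸ Subgroup.centralizer ({γ'} : Set G'))]
  (μ : Measure (G ⧸ Subgroup.centralizer ({γ} : Set G)))
  [SMulInvariantMeasure G (G ⧸ Subgroup.centralizer ({γ} : Set G)) μ] [IsFiniteMeasureOnCompacts μ]
  (μ' : Measure (G' ⧸ Subgroup.centralizer ({γ'} : Set G')))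
  [SMulInvariantMeasure G' (G' ⧸ Subgroup.centralizer ({γ'} : Set G')) μ'] [IsFiniteMeasureOnCompacts μ']

include he hes hγ in
/-- **Orbital integrals along a bicontinuous isomorphism** `e : G ≃* G'` with `e γ = γ'` (`G'`
locally compact, second countable, Hausdorff; `μ`, `μ'` non-zero invariant measures finite on compact
sets): there is ONE `c ≠ 0` with `O_{γ'}(F; μ') = c • O_γ(F ∘ e; μ)` for every complex `F`
(★ `exists_integral_descConj_eq_smul_integral_descConj_comp` in named form). Gelbart (1975), p. 155:
the orbital integrals away from `S` of (10.14) and (10.15) are identified through `G'_S = G_S`.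
[cite: Gelbart1975, p. 155] -/
theorem exists_orbitalIntegral_eq_smul_orbitalIntegral_comp (hμ : μ ≠ 0) (hμ' : μ' ≠ 0) :
    ∃ c : ℝ≥0, c ≠ 0 ∧ ∀ F : G' → ℂ,
      orbitalIntegral γ' F μ' = c • orbitalIntegral γ (F ∘ e) μ := by
  simp only [orbitalIntegral_eq_integral_descConj]
  exact exists_integral_descConj_eq_smul_integral_descConj_comp e he hes hγ μ μ' hμ hμ'

end Transport

/-! ### Between conjugate elements -/

section Conj

variable {G : Type*} [Group G] [TopologicalSpace G] [IsTopologicalGroup G] [LocallyCompactSpace G]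
  [SecondCountableTopology G] [T2Space G] {γ₁ γ₂ : G} (q : G) (hq : q * γ₁ * q⁻¹ = γ₂)
  [MeasurableSpace (G ⧸ Subgroup.centralizer ({γ₁} : Set G))]
  [BorelSpace (G ⧸ Subgroup.centralizer ({γ₁} : Set G))]
  [MeasurableSpace (G ⧸ Subgroup.centralizer ({γ₂} : Set G))]
  [BorelSpace (G ⧸ Subgroup.centralizer ({γ₂} : Set G))]
  (μ₁ : Measure (G ⧸ Subgroup.centralizer ({γ₁} : Set G)))
  [SMulInvariantMeasure G (G ⧸ Subgroup.centralizer ({γ₁} : Set G)) μ₁] [IsFiniteMeasureOnCompacts μ₁]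
  (μ₂ : Measure (G ⧸ Subgroup.centralizer ({γ₂} : Set G)))
  [SMulInvariantMeasure G (G ⧸ Subgroup.centralizer ({γ₂} : Set G)) μ₂] [IsFiniteMeasureOnCompacts μ₂]

include hq in
/-- **The orbital integral is a class function up to the normalisation of the measures**: for
`γ₂ = q γ₁ q⁻¹` and non-zero invariant measures `μ_i` on `G ⧸ C(γ_i)` finite on compact sets there is
ONE `c ≠ 0` with `O_{γ₂}(F; μ₂) = c • O_{γ₁}(F; μ₁)` for every complex `F`
(★ `exists_integral_descConj_eq_smul_integral_descConj_of_conj_eq`). [cite: Gelbart1975, p. 154 (10.14)] -/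
theorem exists_orbitalIntegral_eq_smul_orbitalIntegral_of_conj_eq (hμ₁ : μ₁ ≠ 0) (hμ₂ : μ₂ ≠ 0) :
    ∃ c : ℝ≥0, c ≠ 0 ∧ ∀ F : G → ℂ, orbitalIntegral γ₂ F μ₂ = c • orbitalIntegral γ₁ F μ₁ := by
  simp only [orbitalIntegral_eq_integral_descConj]
  exact exists_integral_descConj_eq_smul_integral_descConj_of_conj_eq q hq μ₁ μ₂ hμ₁ hμ₂

end Conj

/-! ### Both at once -/

section TransportConj

variable {G G' : Type*} [Group G] [Group G'] [TopologicalSpace G] [TopologicalSpace G']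
  [IsTopologicalGroup G] [IsTopologicalGroup G'] [LocallyCompactSpace G'] [SecondCountableTopology G']
  [T2Space G'] (e : G ≃* G') (he : Continuous e) (hes : Continuous e.symm) {γ : G} {γ₂ : G'} (q : G')
  (hq : q * e γ * q⁻¹ = γ₂)
  [MeasurableSpace (G ⧸ Subgroup.centralizer ({γ} : Set G))]
  [BorelSpace (G ⧸ Subgroup.centralizer ({γ} : Set G))]
  [MeasurableSpace (G' ⧸ Subgroup.centralizer ({γ₂} : Set G'))]
  [BorelSpace (G' ⧸ Subgroup.centralizer ({γ₂} : Set G'))]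
  (μ : Measure (G ⧸ Subgroup.centralizer ({γ} : Set G)))
  [SMulInvariantMeasure G (G ⧸ Subgroup.centralizer ({γ} : Set G)) μ] [IsFiniteMeasureOnCompacts μ]
  (μ₂ : Measure (G' ⧸ Subgroup.centralizer ({γ₂} : Set G')))
  [SMulInvariantMeasure G' (G' ⧸ Subgroup.centralizer ({γ₂} : Set G')) μ₂] [IsFiniteMeasureOnCompacts μ₂]

include he hes hq in
/-- **Orbital integrals along an isomorphism, up to conjugacy in the target**: for a bicontinuous
`e : G ≃* G'`, `q e(γ) q⁻¹ = γ₂`, and non-zero invariant measures `μ` on `G ⧸ C(γ)`, `μ₂` on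
`G' ⧸ C(γ₂)`: ONE `c ≠ 0` with `O_{γ₂}(F; μ₂) = c • O_γ(F ∘ e; μ)` for every complex `F`
(★ `exists_integral_descConj_eq_smul_integral_descConj_comp_of_conj_eq`). [cite: Gelbart1975, pp. 154–155] -/
theorem exists_orbitalIntegral_eq_smul_orbitalIntegral_comp_of_conj_eq (hμ : μ ≠ 0) (hμ₂ : μ₂ ≠ 0) :
    ∃ c : ℝ≥0, c ≠ 0 ∧ ∀ F : G' → ℂ,
      orbitalIntegral γ₂ F μ₂ = c • orbitalIntegral γ (F ∘ e) μ := by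
  simp only [orbitalIntegral_eq_integral_descConj]
  exact exists_integral_descConj_eq_smul_integral_descConj_comp_of_conj_eq e he hes q hq μ μ₂ hμ hμ₂

end TransportConj

/-! ### The unitary group: orbital integrals along a local isomorphism `ψ : U(H)(L⁺_v) ≃ U(H′)(L⁺_v)` -/

namespace UnitaryGroup

variable (L : Type) [Field L] [NumberField L] [IsCMField L] (N : ℕ) (H H' : Matrix (Fin N) (Fin N) L)
  (v : HeightOneSpectrum (𝓞 ↥(maximalRealSubfield L)))
  [LocallyCompactSpace ((cmDatum L N H').Local v)] [SecondCountableTopology ((cmDatum L N H').Local v)]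
  [T2Space ((cmDatum L N H').Local v)]
  (ψ : (cmDatum L N H).Local v ≃ₜ* (cmDatum L N H').Local v) {γ : (cmDatum L N H).Local v}
  [MeasurableSpace ((cmDatum L N H).Local v ⧸
    Subgroup.centralizer ({γ} : Set ((cmDatum L N H).Local v)))]
  [BorelSpace ((cmDatum L N H).Local v ⧸ Subgroup.centralizer ({γ} : Set ((cmDatum L N H).Local v)))]
  [MeasurableSpace ((cmDatum L N H').Local v ⧸
    Subgroup.centralizer ({ψ γ} : Set ((cmDatum L N H').Local v)))]
  [BorelSpace ((cmDatum L N H').Local v ⧸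
    Subgroup.centralizer ({ψ γ} : Set ((cmDatum L N H').Local v)))]
  (μ : Measure ((cmDatum L N H).Local v ⧸ Subgroup.centralizer ({γ} : Set ((cmDatum L N H).Local v))))
  [SMulInvariantMeasure ((cmDatum L N H).Local v) _ μ] [IsFiniteMeasureOnCompacts μ]
  (μ' : Measure ((cmDatum L N H').Local v ⧸
    Subgroup.centralizer ({ψ γ} : Set ((cmDatum L N H').Local v))))
  [SMulInvariantMeasure ((cmDatum L N H').Local v) _ μ'] [IsFiniteMeasureOnCompacts μ']

/-- **Local orbital integrals along a local isomorphism of unitary groups** `ψ : U(H)(L⁺_v) ≃ₜ*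
U(H′)(L⁺_v)` (e.g. the identifications `G′_v ≅ G_v` of the inner form with the quasi-split group at
the finite places, `stub_T1g_locallyQuasiSplit`; `U(H′)(L⁺_v)` locally compact second countable
Hausdorff — binders): for non-zero invariant measures `μ` on `U(H)_v ⧸ C(γ)`, `μ'` on
`U(H′)_v ⧸ C(ψ γ)` there is ONE `c ≠ 0` with `Φ(ψ γ, f; μ') = c • Φ(γ, f ∘ ψ; μ)` for every `f` — the
orbital-integral identity behind (14.2.1) «`f_v = f′_v ∘ ψ_v⁻¹` for `v ∉ S₀ ∪ S`», up to the
normalisation of the measures. [cite: Rogawski1990, §14.2 p. 232] -/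
theorem exists_localOrbitalIntegral_eq_smul_comp (hμ : μ ≠ 0) (hμ' : μ' ≠ 0) :
    ∃ c : ℝ≥0, c ≠ 0 ∧ ∀ f : (cmDatum L N H').Local v → ℂ,
      localOrbitalIntegral L N H' v (ψ γ) f μ' = c • localOrbitalIntegral L N H v γ (f ∘ ψ) μ :=
  exists_orbitalIntegral_eq_smul_orbitalIntegral_comp ψ.toMulEquiv ψ.continuous ψ.symm.continuous rfl
    μ μ' hμ hμ'

end UnitaryGroup

end Literature.NumberTheory.Automorphic
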